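import Mathlib
import Summits.ValiantsHypothesis.ValiantsHypothesis.Theorems.NewtonUnitEquationsNewtonTauWeakCornerDefs

/-!
# `NewtonTauWeak` (stmt-ValiantsHypothesis-5904), line `binomial-normal-form`, stub `fixedKCoincidence_t2_K3`:
# sign sets of real weights are nested threshold sets

Support file for the registered sub-stub `fixedKCoincidence_t2_K3` of the crux
`Summit.ValiantsHypothesis.ValiantsHypothesis.Theses.NewtonUnitEquations.NewtonTauWeak`.

For a real weight `w` with nonzero coordinates, the set of exponents `d_j ∈ ℕ²` of negative weight is a
threshold set of the slope order (empty for sign type `(+,+)`, all nonzero exponents for `(−,−)`, and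
`{j : d_{j,0} < λ d_{j,1}}` resp. `{j : d_{j,1} < λ d_{j,0}}` for the mixed types).  Hence two weights of the same
sign type have NESTED sign sets (`k2_signSet_nested`, registered helper stub), and a sign set is determined by the
sign type together with its cardinality — the counting device of the global assembly of the stub (at most
`4 (N + 1)` sign sets arise, with no sweep over critical slopes needed).

No definitions. [folklore]
-/

-- the namespace mandated for this Theorems file repeats the component `ValiantsHypothesis`
set_option linter.dupNamespace false

noncomputable section

open scoped BigOperators

namespace Summit.ValiantsHypothesis.ValiantsHypothesis.Theorems.NewtonTauWeakCorner

/-! ## §3 Sign sets of real weights are threshold sets -/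

/-- Threshold monotonicity, sign type `(+, −)`: `j` has negative weight iff `d₀ < (−u₁/u₀) d₁`. [folklore] -/
theorem k2_signSet_mono_pm {N : ℕ} (d : Fin N → (Fin 2 →₀ ℕ)) (u u' : Fin 2 → ℝ)
    (hu0 : 0 < u 0) (hu0' : 0 < u' 0) (hle : -u 1 * u' 0 ≤ -u' 1 * u 0) :
    Finset.univ.filter (fun j => wt u (fun i => (d j i : ℤ)) < 0)
      ⊆ Finset.univ.filter (fun j => wt u' (fun i => (d j i : ℤ)) < 0) := by
  classical
  intro j hj
  rw [Finset.mem_filter] at hj ⊢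
  refine ⟨Finset.mem_univ j, ?_⟩
  have hwt : ∀ (v : Fin 2 → ℝ), wt v (fun i => (d j i : ℤ)) = v 0 * (d j 0 : ℝ) + v 1 * (d j 1 : ℝ) := by
    intro v; simp [wt]
  rw [hwt] at hj ⊢
  have hd1 : (0 : ℝ) ≤ (d j 1 : ℝ) := by positivity
  have hj' : u 0 * (d j 0 : ℝ) < -u 1 * (d j 1 : ℝ) := by linarith [hj.2]
  have A : u' 0 * (u 0 * (d j 0 : ℝ)) < u' 0 * (-u 1 * (d j 1 : ℝ)) := mul_lt_mul_of_pos_left hj' hu0'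
  have B : (-u 1 * u' 0) * (d j 1 : ℝ) ≤ (-u' 1 * u 0) * (d j 1 : ℝ) := mul_le_mul_of_nonneg_right hle hd1
  have C : u 0 * (u' 0 * (d j 0 : ℝ)) < u 0 * (-u' 1 * (d j 1 : ℝ)) := by
    calc u 0 * (u' 0 * (d j 0 : ℝ)) = u' 0 * (u 0 * (d j 0 : ℝ)) := by ring
      _ < u' 0 * (-u 1 * (d j 1 : ℝ)) := A
      _ = (-u 1 * u' 0) * (d j 1 : ℝ) := by ring
      _ ≤ (-u' 1 * u 0) * (d j 1 : ℝ) := B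
      _ = u 0 * (-u' 1 * (d j 1 : ℝ)) := by ring
  have D : u' 0 * (d j 0 : ℝ) < -u' 1 * (d j 1 : ℝ) := lt_of_mul_lt_mul_left C hu0.le
  linarith

/-- Threshold monotonicity, sign type `(−, +)`. [folklore] -/
theorem k2_signSet_mono_mp {N : ℕ} (d : Fin N → (Fin 2 →₀ ℕ)) (u u' : Fin 2 → ℝ)
    (hu1 : 0 < u 1) (hu1' : 0 < u' 1) (hle : -u 0 * u' 1 ≤ -u' 0 * u 1) :
    Finset.univ.filter (fun j => wt u (fun i => (d j i : ℤ)) < 0)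
      ⊆ Finset.univ.filter (fun j => wt u' (fun i => (d j i : ℤ)) < 0) := by
  classical
  intro j hj
  rw [Finset.mem_filter] at hj ⊢
  refine ⟨Finset.mem_univ j, ?_⟩
  have hwt : ∀ (v : Fin 2 → ℝ), wt v (fun i => (d j i : ℤ)) = v 0 * (d j 0 : ℝ) + v 1 * (d j 1 : ℝ) := by
    intro v; simp [wt]
  rw [hwt] at hj ⊢
  have hd0 : (0 : ℝ) ≤ (d j 0 : ℝ) := by positivity
  have hj' : u 1 * (d j 1 : ℝ) < -u 0 * (d j 0 : ℝ) := by linarith [hj.2]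
  have A : u' 1 * (u 1 * (d j 1 : ℝ)) < u' 1 * (-u 0 * (d j 0 : ℝ)) := mul_lt_mul_of_pos_left hj' hu1'
  have B : (-u 0 * u' 1) * (d j 0 : ℝ) ≤ (-u' 0 * u 1) * (d j 0 : ℝ) := mul_le_mul_of_nonneg_right hle hd0
  have C : u 1 * (u' 1 * (d j 1 : ℝ)) < u 1 * (-u' 0 * (d j 0 : ℝ)) := by
    calc u 1 * (u' 1 * (d j 1 : ℝ)) = u' 1 * (u 1 * (d j 1 : ℝ)) := by ring
      _ < u' 1 * (-u 0 * (d j 0 : ℝ)) := A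
      _ = (-u 0 * u' 1) * (d j 0 : ℝ) := by ring
      _ ≤ (-u' 0 * u 1) * (d j 0 : ℝ) := B
      _ = u 1 * (-u' 0 * (d j 0 : ℝ)) := by ring
  have D : u' 1 * (d j 1 : ℝ) < -u' 0 * (d j 0 : ℝ) := lt_of_mul_lt_mul_left C hu1.le
  linarith

/-- **Nested sign sets.** For real weights `w, w'` with nonzero coordinates of the same signs, the sets of
exponents of negative weight are nested. [folklore] -/
theorem k2_signSet_nested {N : ℕ} (d : Fin N → (Fin 2 →₀ ℕ)) (w w' : Fin 2 → ℝ)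
    (hw0 : w 0 ≠ 0) (hw1 : w 1 ≠ 0) (hw0' : w' 0 ≠ 0) (hw1' : w' 1 ≠ 0)
    (h0 : 0 < w 0 ↔ 0 < w' 0) (h1 : 0 < w 1 ↔ 0 < w' 1) :
    Finset.univ.filter (fun j => wt w (fun i => (d j i : ℤ)) < 0)
        ⊆ Finset.univ.filter (fun j => wt w' (fun i => (d j i : ℤ)) < 0) ∨
      Finset.univ.filter (fun j => wt w' (fun i => (d j i : ℤ)) < 0)
        ⊆ Finset.univ.filter (fun j => wt w (fun i => (d j i : ℤ)) < 0) := by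
  classical
  have hwt : ∀ (v : Fin 2 → ℝ) j, wt v (fun i => (d j i : ℤ)) = v 0 * (d j 0 : ℝ) + v 1 * (d j 1 : ℝ) := by
    intro v j; simp [wt]
  rcases lt_or_gt_of_ne hw0 with hn0 | hp0 <;> rcases lt_or_gt_of_ne hw1 with hn1 | hp1
  · -- (−,−): `S w ⊆ S w'`
    have hn0' : w' 0 < 0 := lt_of_le_of_ne (not_lt.mp fun h => (lt_irrefl _ ((h0.mpr h).trans hn0)).elim) hw0'
    have hn1' : w' 1 < 0 := lt_of_le_of_ne (not_lt.mp fun h => (lt_irrefl _ ((h1.mpr h).trans hn1)).elim) hw1'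
    left
    intro j hj
    rw [Finset.mem_filter, hwt] at hj ⊢
    refine ⟨Finset.mem_univ j, ?_⟩
    have hd0 : (0 : ℝ) ≤ (d j 0 : ℝ) := by positivity
    have hd1 : (0 : ℝ) ≤ (d j 1 : ℝ) := by positivity
    have hpos : (0 : ℝ) < (d j 0 : ℝ) ∨ (0 : ℝ) < (d j 1 : ℝ) := by
      by_contra h
      push Not at h
      have e0 : (d j 0 : ℝ) = 0 := le_antisymm h.1 hd0
      have e1 : (d j 1 : ℝ) = 0 := le_antisymm h.2 hd1
      rw [e0, e1] at hj
      linarith [hj.2]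
    rcases hpos with h | h
    · nlinarith [mul_pos_of_neg_of_neg hn0' (show -(d j 0 : ℝ) < 0 by linarith)]
    · nlinarith [mul_pos_of_neg_of_neg hn1' (show -(d j 1 : ℝ) < 0 by linarith)]
  · -- (−,+)
    have hp1' : 0 < w' 1 := h1.mp hp1
    rcases le_total (-w 0 * w' 1) (-w' 0 * w 1) with hle | hle
    · exact Or.inl (k2_signSet_mono_mp d w w' hp1 hp1' hle)
    · exact Or.inr (k2_signSet_mono_mp d w' w hp1' hp1 hle)
  · -- (+,−)
    have hp0' : 0 < w' 0 := h0.mp hp0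
    rcases le_total (-w 1 * w' 0) (-w' 1 * w 0) with hle | hle
    · exact Or.inl (k2_signSet_mono_pm d w w' hp0 hp0' hle)
    · exact Or.inr (k2_signSet_mono_pm d w' w hp0' hp0 hle)
  · -- (+,+): `S w = ∅`
    left
    intro j hj
    rw [Finset.mem_filter, hwt] at hj
    exfalso
    have hd0 : (0 : ℝ) ≤ (d j 0 : ℝ) := by positivity
    have hd1 : (0 : ℝ) ≤ (d j 1 : ℝ) := by positivity
    nlinarith [hj.2, mul_nonneg hp0.le hd0, mul_nonneg hp1.le hd1]

end Summit.ValiantsHypothesis.ValiantsHypothesis.Theorems.NewtonTauWeakCorner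

end
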